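import Summits.Ventures.YMGap.FlowData.SU2WeightCharacterSeries
import Summits.Ventures.YMGap.FlowData.TwoDimTorelonBound
import HarnessLib

/-!
# Venture YMGap, track Y3 FLOW-DATA — the SU(2) RING HAAR CHAIN in characters and the CHARACTER EXPANSION OF
# THE CIRCLE SLICE KERNEL `K(a,b) = Σ_n (c_n(β)/(n+1))^L χ_n(hol a) χ_n(hol b)` (slice `k = 1`; theorems only)

HONEST FRAMING: venture file of the cell `pub-ymgap` (QuantumFields programme), track Y3; companion THEOREMS
preparing the d = 2 EQUALITY `E₁((ℤ/L)¹; β) = L·(−ln u(β))` for the typed tube objects of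
`FlowData/TorelonEnergy.lean` (file 2/4).  Finite Haar integrals over `SU(2)`; no number, no row, nothing about
limits or a mass gap.  NO Peter–Weyl (see file 1/4 `FlowData/SU2WeightCharacterSeries.lean`; the handle identity
`∫ χ_n(AVBV⁻¹) dV = χ_n(A)χ_n(B)/(n+1)` is the prior venture's `SU2HandleIdentity`).

* `integral_characterSeries_handle` — the handle closes a ring of length one:
  `∫ Σ_n c_n χ_n(V β V⁻¹ α⁻¹) dV = Σ_n c_n χ_n(α) χ_n(β)/(n+1)`;
* **`integral_ring_weight_characterSeries`** — THE RING: for `m + 1` group elements `E₀, …, E_m` on a cycle,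
  Wilson weights `e^{b a₀(E_s β_s E_{s+1}⁻¹ α_s⁻¹)}` on the bonds `s < m` and a character series
  `Σ_n c_n χ_n(E_m β_m E₀⁻¹ α_m⁻¹)` on the closing bond (`Σ (n+1)|c_n| < ∞`),
  `∫ (∏_{s<m} w) (Σ_n c_n χ_n) dE^{⊗(m+1)} = Σ_n c_n (c_n(b)/(n+1))^m χ_n(∏ₛ αₛ) χ_n(∏ₛ βₛ)/(n+1)`
  (induction on `m`: peel the last group element by `measurePreserving_piFinSuccAbove`, merge the two bonds through
  it with `integral_weight_mul_su2Character`, close with the handle);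
* **`su2_sliceKernel_sliceOne_eq_tsum`** — THE CIRCLE KERNEL: for the cell's ACTUAL typed objects (the tree's
  `SlabTransferKernel.sliceKernel` of `FlowData/TubeTransferOperator.lean`, `G = SU(2)`, `ρ` fundamental, `J = β/2`,
  slice dimension `k = 1`), at EVERY pair of slice configurations,
  `sliceKernel ρ (β/2) (β/2) a b = Σ_n (c_n(β)/(n+1))^L χ_n(hol a) χ_n(hol b)` (`β ≥ 0`; no spatial plaquettes,
  `magSum_sliceOne`; the `L` temporal plaquettes are the ring with `c = c(β)`; sites `t ê₀ ↔ Fin L` transported by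
  `measurePreserving_piCongrLeft`).  Files 3/4–4/4 (`FlowData/CircleSpectralResolution.lean`, `FlowData/TwoDimTorelonEquality.lean`) turn this into
  the spectral resolution of the circle transfer operator and `E₁ = L·(−ln u)`.

References: A. A. Migdal, Sov. Phys. JETP 42 (1975) 413; I. Montvay, G. Münster (1994) §3.2.6
[cite: MontvayMunster1994, §3.2.6].
-/

noncomputable section

open scoped BigOperators Topology
open MeasureTheory Filter Function Set Polynomial.Chebyshev
open Literature.MathematicalPhysics.QuantumFieldTheory Literature.MathematicalPhysics.QuantumLattice Literature.Analysis.FunctionSpaces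
open Summit.Ventures.LatticeQCDFlow.Exactness Summit.Ventures.LatticeQCDFlow.Scoring

namespace Summit.Ventures.YMGap.FlowData

/-! ### The closed ring of temporal plaquettes -/

section Ring

/-- **The handle closes the ring of length one**: `∫ (Σ_n c_n χ_n(V β V⁻¹ α⁻¹)) dV = Σ_n c_n χ_n(α) χ_n(β)/(n+1)`.
[cite: MontvayMunster1994, §3.2.6] -/
theorem integral_characterSeries_handle {c : ℕ → ℝ} (hc : Summable fun n : ℕ => ((n : ℝ) + 1) * |c n|)
    (α β : Matrix.specialUnitaryGroup (Fin 2) ℂ) :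
    ∫ V, ∑' n : ℕ, c n * (U ℝ n).eval (su2a0 (V * β * V⁻¹ * α⁻¹))
        ∂haarProbability (Matrix.specialUnitaryGroup (Fin 2) ℂ) =
      ∑' n : ℕ, c n * ((U ℝ n).eval (su2a0 α) * (U ℝ n).eval (su2a0 β) / (n + 1)) := by
  have h := integral_characterSeries_mul hc (g := fun _ => (1 : ℝ)) (C := 1) (fun _ => by simp)
    aestronglyMeasurable_const (fun V => V * β * V⁻¹ * α⁻¹)
    (((continuous_id.mul continuous_const).mul continuous_inv).mul continuous_const)
  simp only [mul_one] at h
  rw [h]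
  refine tsum_congr fun n => ?_
  congr 1
  have hcyc : ∀ V : Matrix.specialUnitaryGroup (Fin 2) ℂ, su2a0 (V * β * V⁻¹ * α⁻¹) = su2a0 (α⁻¹ * V * β * V⁻¹) :=
    fun V => by rw [su2a0_mul_comm, ← mul_assoc, ← mul_assoc]
  simp_rw [hcyc]
  rw [integral_su2Character_handle α⁻¹ β n, su2a0_inv]

/-- **THE RING HAAR CHAIN IN CHARACTERS.**  For `m + 1` group elements `E₀, …, E_m` on a cycle with twists
`α_s, β_s`, the Wilson weight `e^{b a₀(E_s β_s E_{s+1}⁻¹ α_s⁻¹)}` on the bonds `s < m` and a character series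
`Σ_n c_n χ_n(E_m β_m E₀⁻¹ α_m⁻¹)` (`Σ (n+1)|c_n| < ∞`) on the closing bond,
`∫ ∏_{s<m} w · (Σ_n c_n χ_n) dE = Σ_n c_n (c_n(b)/(n+1))^m χ_n(∏_s α_s) χ_n(∏_s β_s)/(n+1)`:
`m` face mergings and one handle. [cite: MontvayMunster1994, §3.2.6] -/
theorem integral_ring_weight_characterSeries {b : ℝ} (hb : 0 ≤ b) :
    ∀ (m : ℕ) {c : ℕ → ℝ} (_hc : Summable fun n : ℕ => ((n : ℝ) + 1) * |c n|)
      (α β : Fin (m + 1) → Matrix.specialUnitaryGroup (Fin 2) ℂ),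
    ∫ E : Fin (m + 1) → Matrix.specialUnitaryGroup (Fin 2) ℂ,
        (∏ s : Fin m, Real.exp (b * su2a0 (E s.castSucc * β s.castSucc * (E s.succ)⁻¹ * (α s.castSucc)⁻¹))) *
          ∑' n : ℕ, c n * (U ℝ n).eval (su2a0 (E (Fin.last m) * β (Fin.last m) * (E 0)⁻¹ * (α (Fin.last m))⁻¹))
        ∂Measure.pi (fun _ => haarProbability (Matrix.specialUnitaryGroup (Fin 2) ℂ)) =
      ∑' n : ℕ, c n * ((besselI n b - besselI (n + 2) b) / (n + 1)) ^ m *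
        ((U ℝ n).eval (su2a0 (List.ofFn α).prod) * (U ℝ n).eval (su2a0 (List.ofFn β).prod) / (n + 1)) := by
  intro m
  induction m with
  | zero =>
    intro c hc α β
    -- one group element: the handle
    show ∫ E : Fin 1 → (Matrix.specialUnitaryGroup (Fin 2) ℂ), (∏ s : Fin 0, Real.exp (b * su2a0 (E s.castSucc *
        β s.castSucc * (E s.succ)⁻¹ * (α s.castSucc)⁻¹))) * ∑' n : ℕ, c n * (U ℝ n).eval (su2a0 (E (Fin.last 0) *
        β (Fin.last 0) * (E 0)⁻¹ * (α (Fin.last 0))⁻¹))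
        ∂Measure.pi (fun _ : Fin 1 => haarProbability (Matrix.specialUnitaryGroup (Fin 2) ℂ)) = _
    have hmp : MeasurePreserving (MeasurableEquiv.funUnique (Fin 1) (Matrix.specialUnitaryGroup (Fin 2) ℂ))
        (Measure.pi fun _ : Fin 1 => haarProbability (Matrix.specialUnitaryGroup (Fin 2) ℂ))
        (haarProbability (Matrix.specialUnitaryGroup (Fin 2) ℂ)) := measurePreserving_funUnique _ _
    rw [← hmp.symm.integral_comp']
    have h0 : ∀ y : Matrix.specialUnitaryGroup (Fin 2) ℂ,
        (MeasurableEquiv.funUnique (Fin 1) (Matrix.specialUnitaryGroup (Fin 2) ℂ)).symm y 0 = y := fun y => rfl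
    simp only [Finset.univ_eq_empty, Finset.prod_empty, one_mul, pow_zero, mul_one, Fin.last_zero, h0,
      List.ofFn_succ, List.ofFn_zero, List.prod_cons, List.prod_nil]
    exact integral_characterSeries_handle hc (α 0) (β 0)
  | succ m ih =>
    intro c hc α β
    -- the merged data of the shorter ring
    set c' : ℕ → ℝ := fun n => c n * ((besselI n b - besselI (n + 2) b) / (n + 1)) with hc'
    set α' : Fin (m + 1) → (Matrix.specialUnitaryGroup (Fin 2) ℂ) := Fin.snoc (fun t : Fin m => α t.castSucc.castSucc)
      (α (Fin.last m).castSucc * α (Fin.last (m + 1))) with hα'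
    set β' : Fin (m + 1) → (Matrix.specialUnitaryGroup (Fin 2) ℂ) := Fin.snoc (fun t : Fin m => β t.castSucc.castSucc)
      (β (Fin.last m).castSucc * β (Fin.last (m + 1))) with hβ'
    have hc'sum : Summable fun n : ℕ => ((n : ℝ) + 1) * |c' n| := by
      refine Summable.of_nonneg_of_le (fun n => by positivity) (fun n => ?_) (hc.mul_right (besselI 0 b))
      have h1 : |c' n| = |c n| * ((besselI n b - besselI (n + 2) b) / (n + 1)) := by
        rw [hc', abs_mul, abs_of_nonneg (div_nonneg (besselISub_nonneg hb n) (by positivity))]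
      have h2 : (besselI n b - besselI (n + 2) b) / (n + 1) ≤ besselI 0 b := by
        rw [div_le_iff₀ (by positivity : (0 : ℝ) < n + 1)]
        have h3 : besselI n b ≤ besselI 0 b := besselI_antitone hb (Nat.zero_le n)
        have h4 : 0 ≤ besselI (n + 2) b := besselI_nonneg (n + 2) hb
        have h5 : 0 ≤ besselI 0 b := besselI_nonneg 0 hb
        nlinarith
      rw [h1, ← mul_assoc]
      exact mul_le_mul_of_nonneg_left h2 (by positivity)
    -- the integrand and its value on `snoc E' g`
    set f : (Fin (m + 2) → (Matrix.specialUnitaryGroup (Fin 2) ℂ)) → ℝ := fun E =>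
      (∏ s : Fin (m + 1), Real.exp (b * su2a0 (E s.castSucc * β s.castSucc * (E s.succ)⁻¹ * (α s.castSucc)⁻¹))) *
        ∑' n : ℕ, c n * (U ℝ n).eval (su2a0 (E (Fin.last (m + 1)) * β (Fin.last (m + 1)) * (E 0)⁻¹ *
          (α (Fin.last (m + 1)))⁻¹)) with hf
    set A : (Fin (m + 1) → (Matrix.specialUnitaryGroup (Fin 2) ℂ)) → ℝ := fun E' =>
      ∏ t : Fin m, Real.exp (b * su2a0 (E' t.castSucc * β' t.castSucc * (E' t.succ)⁻¹ * (α' t.castSucc)⁻¹)) with hA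
    set P : (Fin (m + 1) → (Matrix.specialUnitaryGroup (Fin 2) ℂ)) → (Matrix.specialUnitaryGroup (Fin 2) ℂ) := fun E' => (α (Fin.last m).castSucc)⁻¹ * E' (Fin.last m) * β (Fin.last m).castSucc
      with hP
    set Q : (Fin (m + 1) → (Matrix.specialUnitaryGroup (Fin 2) ℂ)) → (Matrix.specialUnitaryGroup (Fin 2) ℂ) := fun E' => β (Fin.last (m + 1)) * (E' 0)⁻¹ * (α (Fin.last (m + 1)))⁻¹ with hQ
    have hsnoc : ∀ (E' : Fin (m + 1) → (Matrix.specialUnitaryGroup (Fin 2) ℂ)) (g : (Matrix.specialUnitaryGroup (Fin 2) ℂ)), f (Fin.snoc E' g) =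
        A E' * (Real.exp (b * su2a0 (P E' * g⁻¹)) * ∑' n : ℕ, c n * (U ℝ n).eval (su2a0 (g * Q E'))) := by
      intro E' g
      simp only [hf, hA, hP, hQ]
      rw [Fin.prod_univ_castSucc]
      have h0 : (Fin.snoc E' g : Fin (m + 2) → (Matrix.specialUnitaryGroup (Fin 2) ℂ)) 0 = E' 0 := by
        rw [show (0 : Fin (m + 2)) = (0 : Fin (m + 1)).castSucc from rfl, Fin.snoc_castSucc]
      simp only [Fin.snoc_castSucc, Fin.snoc_last, Fin.succ_last, Fin.succ_castSucc, h0]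
      have hα't : ∀ t : Fin m, α' t.castSucc = α t.castSucc.castSucc := fun t => by
        simp only [hα', Fin.snoc_castSucc]
      have hβ't : ∀ t : Fin m, β' t.castSucc = β t.castSucc.castSucc := fun t => by
        simp only [hβ', Fin.snoc_castSucc]
      simp only [hα't, hβ't]
      have hw : su2a0 (E' (Fin.last m) * β (Fin.last m).castSucc * g⁻¹ * (α (Fin.last m).castSucc)⁻¹) =
          su2a0 ((α (Fin.last m).castSucc)⁻¹ * E' (Fin.last m) * β (Fin.last m).castSucc * g⁻¹) := by
        rw [su2a0_mul_comm, ← mul_assoc, ← mul_assoc]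
      rw [hw]
      simp only [mul_assoc]
    -- peel the last group element
    set e := MeasurableEquiv.piFinSuccAbove (fun _ : Fin (m + 2) => (Matrix.specialUnitaryGroup (Fin 2) ℂ)) (Fin.last (m + 1)) with he
    have hmp : MeasurePreserving e (Measure.pi fun _ : Fin (m + 2) => haarProbability (Matrix.specialUnitaryGroup (Fin 2) ℂ))
        ((haarProbability (Matrix.specialUnitaryGroup (Fin 2) ℂ)).prod (Measure.pi fun _ : Fin (m + 1) => haarProbability (Matrix.specialUnitaryGroup (Fin 2) ℂ))) :=
      measurePreserving_piFinSuccAbove (fun _ : Fin (m + 2) => haarProbability (Matrix.specialUnitaryGroup (Fin 2) ℂ)) (Fin.last (m + 1))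
    have hesymm : ∀ p : (Matrix.specialUnitaryGroup (Fin 2) ℂ) × (Fin (m + 1) → (Matrix.specialUnitaryGroup (Fin 2) ℂ)), e.symm p = Fin.snoc p.2 p.1 := fun p => by
      simp only [he, MeasurableEquiv.piFinSuccAbove_symm_apply, Fin.insertNthEquiv_last]
      rfl
    have hfc : Continuous f := by
      have h1 : Continuous fun E : Fin (m + 2) → (Matrix.specialUnitaryGroup (Fin 2) ℂ) => ∏ s : Fin (m + 1),
          Real.exp (b * su2a0 (E s.castSucc * β s.castSucc * (E s.succ)⁻¹ * (α s.castSucc)⁻¹)) :=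
        continuous_finsetProd _ fun s _ => by
          have h : Continuous fun E : Fin (m + 2) → (Matrix.specialUnitaryGroup (Fin 2) ℂ) =>
              E s.castSucc * β s.castSucc * (E s.succ)⁻¹ * (α s.castSucc)⁻¹ := by fun_prop
          exact Real.continuous_exp.comp (continuous_const.mul (continuous_su2a0.comp h))
      have h2 : Continuous fun E : Fin (m + 2) → (Matrix.specialUnitaryGroup (Fin 2) ℂ) => ∑' n : ℕ, c n * (U ℝ n).eval (su2a0 (E (Fin.last (m + 1)) *
          β (Fin.last (m + 1)) * (E 0)⁻¹ * (α (Fin.last (m + 1)))⁻¹)) :=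
        (continuous_characterSeries hc).comp (by fun_prop)
      exact h1.mul h2
    have hfi : Integrable f (Measure.pi fun _ : Fin (m + 2) => haarProbability (Matrix.specialUnitaryGroup (Fin 2) ℂ)) :=
      hfc.integrable_of_hasCompactSupport (HasCompactSupport.of_compactSpace _)
    have hFi : Integrable (fun p : (Matrix.specialUnitaryGroup (Fin 2) ℂ) × (Fin (m + 1) → (Matrix.specialUnitaryGroup (Fin 2) ℂ)) => f (e.symm p)) ((haarProbability (Matrix.specialUnitaryGroup (Fin 2) ℂ)).prod (Measure.pi fun _ => haarProbability (Matrix.specialUnitaryGroup (Fin 2) ℂ))) :=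
      (hmp.symm.integrable_comp_emb e.symm.measurableEmbedding).2 hfi
    change ∫ E, f E ∂Measure.pi (fun _ => haarProbability (Matrix.specialUnitaryGroup (Fin 2) ℂ)) = _
    rw [← hmp.symm.integral_comp' f, integral_prod_symm _ hFi]
    simp only [hesymm, hsnoc]
    simp_rw [integral_const_mul]
    -- the inner integral: one-link merging, term by term
    have hinner : ∀ E' : Fin (m + 1) → (Matrix.specialUnitaryGroup (Fin 2) ℂ),
        ∫ g, Real.exp (b * su2a0 (P E' * g⁻¹)) * ∑' n : ℕ, c n * (U ℝ n).eval (su2a0 (g * Q E')) ∂haarProbability (Matrix.specialUnitaryGroup (Fin 2) ℂ) =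
          ∑' n : ℕ, c' n * (U ℝ n).eval (su2a0 (E' (Fin.last m) * β' (Fin.last m) * (E' 0)⁻¹ * (α' (Fin.last m))⁻¹)) := by
      intro E'
      have hg : ∀ g : (Matrix.specialUnitaryGroup (Fin 2) ℂ), |Real.exp (b * su2a0 (P E' * g⁻¹))| ≤ Real.exp b := fun g => by
        rw [abs_of_pos (Real.exp_pos _), Real.exp_le_exp]
        have := (abs_le.1 (abs_su2a0_le_one (P E' * g⁻¹))).2
        nlinarith
      have h1 := integral_characterSeries_mul hc (g := fun g => Real.exp (b * su2a0 (P E' * g⁻¹))) (C := Real.exp b) hg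
        ((Real.continuous_exp.comp (continuous_const.mul (continuous_su2a0.comp (continuous_const.mul
          continuous_inv)))).aestronglyMeasurable) (fun g => g * Q E') (continuous_id.mul continuous_const)
      simp_rw [mul_comm (Real.exp (b * su2a0 (P E' * _⁻¹))) (∑' n : ℕ, _)]
      rw [h1]
      refine tsum_congr fun n => ?_
      simp_rw [mul_comm ((U ℝ n).eval _) (Real.exp _)]
      rw [integral_weight_mul_su2Character hb n (P E') (Q E'), hc']
      simp only [hP, hQ, hα', hβ', Fin.snoc_last]
      have hcyc : su2a0 ((α (Fin.last m).castSucc)⁻¹ * E' (Fin.last m) * β (Fin.last m).castSucc *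
          (β (Fin.last (m + 1)) * (E' 0)⁻¹ * (α (Fin.last (m + 1)))⁻¹)) =
          su2a0 (E' (Fin.last m) * (β (Fin.last m).castSucc * β (Fin.last (m + 1))) * (E' 0)⁻¹ *
            (α (Fin.last m).castSucc * α (Fin.last (m + 1)))⁻¹) := by
        rw [mul_inv_rev]
        simp only [mul_assoc]
        conv_lhs => rw [su2a0_mul_comm]
        simp only [mul_assoc]
      rw [hcyc]
      ring
    simp_rw [hinner]
    -- the shorter ring
    have hih := ih hc'sum α' β'
    simp only [hA] at hih ⊢
    rw [hih]
    -- bookkeeping of the products and coefficients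
    have hαprod : (List.ofFn α').prod = (List.ofFn α).prod := by
      rw [List.ofFn_succ' α', List.ofFn_succ' α, List.ofFn_succ' (fun i : Fin (m + 1) => α i.castSucc)]
      simp only [List.concat_eq_append, List.prod_append, List.prod_cons, List.prod_nil, mul_one, hα',
        Fin.snoc_castSucc, Fin.snoc_last, mul_assoc]
    have hβprod : (List.ofFn β').prod = (List.ofFn β).prod := by
      rw [List.ofFn_succ' β', List.ofFn_succ' β, List.ofFn_succ' (fun i : Fin (m + 1) => β i.castSucc)]
      simp only [List.concat_eq_append, List.prod_append, List.prod_cons, List.prod_nil, mul_one, hβ',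
        Fin.snoc_castSucc, Fin.snoc_last, mul_assoc]
    rw [hαprod, hβprod]
    refine tsum_congr fun n => ?_
    simp only [hc']
    ring

end Ring

/-! ### The circle slice kernel of the cell's tube objects is the ring: its character expansion -/

section Kernel

open Literature.MathematicalPhysics.QuantumLattice (fundamentalRep)

/-- `Σ_n (n+1) |c_n(b)| < ∞` for `c_n(b) = I_n(b) − I_{n+2}(b)`, `b ≥ 0`. [folklore] -/
theorem summable_succ_mul_abs_besselISub {b : ℝ} (hb : 0 ≤ b) :
    Summable fun n : ℕ => ((n : ℝ) + 1) * |besselI n b - besselI (n + 2) b| :=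
  (summable_succ_mul_besselISub hb).congr fun n => by rw [abs_of_nonneg (besselISub_nonneg hb n)]

/-- The sites of the circle `(ℤ/L)¹` are the points `t ê₀`, `t = 0, …, L−1` (an equivalence `Fin L ≃ Site 1 L`).
[folklore] -/
theorem lineSite_bijective {L : ℕ} [NeZero L] :
    Bijective fun t : Fin L => (Pi.single (0 : Fin 1) ((t : ℕ) : ZMod L) : Site 1 L) := by
  refine ⟨fun s t h => ?_, fun x => ⟨⟨(x 0).val, ZMod.val_lt _⟩, ?_⟩⟩
  · have h0 := congr_fun h 0
    simp only [Pi.single_eq_same] at h0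
    have h1 := congr_arg ZMod.val h0
    rw [ZMod.val_cast_of_lt s.2, ZMod.val_cast_of_lt t.2] at h1
    exact Fin.ext h1
  · funext j
    have hj : j = 0 := Subsingleton.elim _ _
    subst hj
    simp only [Pi.single_eq_same, ZMod.natCast_val, ZMod.cast_id', id_eq]

/-- Consecutive sites: `t ê₀ + ê₀ = (t+1) ê₀`. [folklore] -/
theorem lineSite_add_single {L : ℕ} (t : ℕ) :
    (Pi.single (0 : Fin 1) ((t : ℕ) : ZMod L) : Site 1 L) + Pi.single 0 1 = Pi.single 0 (((t + 1 : ℕ) : ℕ) : ZMod L) := by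
  rw [← Pi.single_add, Nat.cast_add, Nat.cast_one]

/-- **THE CIRCLE SLICE KERNEL IS DIAGONAL IN THE CHARACTERS OF THE HOLONOMY.**  For the SU(2) Wilson action in
slice dimension `k = 1` (theory dimension two), coupling `J = β/2` in front of `Re tr` (`β = β_W ≥ 0`), the tree's
symmetrised slice kernel on the circle `(ℤ/L)¹` is, at EVERY pair of slice configurations,
`K(a, b) = Σ_n (c_n(β)/(n+1))^L χ_n(hol a) χ_n(hol b)`, `c_n(β) = I_n(β) − I_{n+2}(β) = 2(n+1)I_{n+1}(β)/β`,
`hol a = a(0) a(ê₀) ⋯ a((L−1)ê₀)` the holonomy of the circle (no spatial plaquettes; the `L` temporal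
plaquettes form a ring: `L − 1` face mergings and one handle).  [cite: MontvayMunster1994, §3.2.6] -/
theorem su2_sliceKernel_sliceOne_eq_tsum {β : ℝ} (hβ : 0 ≤ β) {L : ℕ} [NeZero L]
    (a b : GaugeConfig 1 L (Matrix.specialUnitaryGroup (Fin 2) ℂ)) :
    sliceKernel (d := 1) (L := L) (fundamentalRep (Fin 2)) (β / 2) (β / 2) a b =
      ∑' n : ℕ, ((besselI n β - besselI (n + 2) β) / (n + 1)) ^ L *
        ((U ℝ n).eval (su2a0 (List.ofFn fun t : Fin L =>
            a (Pi.single (0 : Fin 1) ((t : ℕ) : ZMod L), (0 : Fin 1))).prod) *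
          (U ℝ n).eval (su2a0 (List.ofFn fun t : Fin L =>
            b (Pi.single (0 : Fin 1) ((t : ℕ) : ZMod L), (0 : Fin 1))).prod)) := by
  obtain ⟨m, rfl⟩ : ∃ m, L = m + 1 := Nat.exists_eq_succ_of_ne_zero (NeZero.ne L)
  -- the site equivalence `t ↦ t ê₀`
  set e : Fin (m + 1) ≃ Site 1 (m + 1) := Equiv.ofBijective _ (lineSite_bijective (L := m + 1)) with he
  have he_apply : ∀ t : Fin (m + 1), e t = Pi.single (0 : Fin 1) ((t : ℕ) : ZMod (m + 1)) := fun t => rfl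
  set α : Fin (m + 1) → Matrix.specialUnitaryGroup (Fin 2) ℂ := fun t => a (e t, 0) with hα
  set γ : Fin (m + 1) → Matrix.specialUnitaryGroup (Fin 2) ℂ := fun t => b (e t, 0) with hγ
  set c : ℕ → ℝ := fun n => besselI n β - besselI (n + 2) β with hc
  -- no spatial plaquettes
  simp only [sliceKernel, magSum_sliceOne, mul_zero, Real.exp_zero, one_mul, mul_one]
  -- the temporal plaquettes along the ring, as a function of the temporal links at the sites `e t`
  have hshift : ∀ s : Fin m, e s.castSucc + Pi.single 0 1 = e s.succ := fun s => by
    rw [he_apply, he_apply, lineSite_add_single, Fin.val_castSucc, Fin.val_succ]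
  have hlast : e (Fin.last m) + Pi.single 0 1 = e 0 := by
    rw [he_apply, he_apply, lineSite_add_single, Fin.val_last, Fin.val_zero, ZMod.natCast_self, Nat.cast_zero]
  have hintegrand : ∀ E : Site 1 (m + 1) → Matrix.specialUnitaryGroup (Fin 2) ℂ,
      Real.exp (β / 2 * elecSum (d := 1) (L := m + 1) (fundamentalRep (Fin 2)) a E b) =
        (∏ s : Fin m, Real.exp (β * su2a0 (E (e s.castSucc) * γ s.castSucc * (E (e s.succ))⁻¹ * (α s.castSucc)⁻¹))) *
          ∑' n : ℕ, c n * (U ℝ n).eval (su2a0 (E (e (Fin.last m)) * γ (Fin.last m) * (E (e 0))⁻¹ *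
            (α (Fin.last m))⁻¹)) := by
    intro E
    have hsum : elecSum (d := 1) (L := m + 1) (fundamentalRep (Fin 2)) a E b =
        ∑ t : Fin (m + 1), ((fundamentalRep (Fin 2)) (E (e t) * b (e t, 0) * (E (e t + Pi.single 0 1))⁻¹ *
          (a (e t, 0))⁻¹)).trace.re := by
      unfold elecSum
      simp only [Fin.sum_univ_one]
      exact (Equiv.sum_comp e (fun x : Site 1 (m + 1) => ((fundamentalRep (Fin 2)) (E x * b (x, 0) *
        (E (x + Pi.single 0 1))⁻¹ * (a (x, 0))⁻¹)).trace.re)).symm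
    rw [hsum, Finset.mul_sum, Real.exp_sum]
    simp_rw [su2_weight_eq (β / 2), show 2 * (β / 2) = β by ring]
    rw [Fin.prod_univ_castSucc]
    simp only [hshift, hlast]
    congr 1
    exact ((hasSum_besselISub_mul_su2Character hβ _).tsum_eq).symm
  simp_rw [hintegrand]
  -- transport the temporal-link integral to `Fin (m+1)`-indexed links
  have hmp : MeasurePreserving (MeasurableEquiv.piCongrLeft (fun _ : Site 1 (m + 1) => Matrix.specialUnitaryGroup (Fin 2) ℂ) e)
      (Measure.pi fun _ : Fin (m + 1) => haarProbability (Matrix.specialUnitaryGroup (Fin 2) ℂ))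
      (Measure.pi fun _ : Site 1 (m + 1) => haarProbability (Matrix.specialUnitaryGroup (Fin 2) ℂ)) :=
    measurePreserving_piCongrLeft (fun _ : Site 1 (m + 1) => haarProbability (Matrix.specialUnitaryGroup (Fin 2) ℂ)) e
  rw [← hmp.integral_comp']
  simp only [MeasurableEquiv.piCongrLeft_apply_apply]
  -- the ring
  rw [integral_ring_weight_characterSeries hβ m (summable_succ_mul_abs_besselISub hβ) α γ]
  refine tsum_congr fun n => ?_
  simp only [hα, hγ, he_apply, pow_succ]
  have hn : ((n : ℝ) + 1) ≠ 0 := by positivity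
  field_simp

end Kernel

end Summit.Ventures.YMGap.FlowData
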